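import Summits.QuantumAdvantage.QuantumAdvantage.Theses.MeasureZeroOne

/-!
# Route `MeasureZeroOne`: the support `Dichotomy` (stmt-QuantumAdvantage-1355)

`Dichotomy : ZeroOneLawBPP → BQPNotSmall → (QuantumAdvantage ∨ BPP = EXP)` is pure logic on the
two route statements: `ZeroOneLawBPP` says that either some feasible martingale `d` succeeds on
every language of `BPP` or `BPP = EXP`; `BQPNotSmall` says that no feasible martingale succeeds on
every language of `BQP`.  If `¬ QuantumAdvantage`, i.e. `BQP ⊆ BPP` (the summit is
`∃ L ∈ BQP, L ∉ BPP`), a martingale succeeding on `BPP` succeeds on `BQP`; hence the first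
disjunct of `ZeroOneLawBPP` is impossible and `BPP = EXP`.

HONEST FRAMING: a closed support item of a sibling route (settled by logic alone), NOT summit
progress; the route's cruxes are untouched.
-/

set_option linter.dupNamespace false -- D-0017: single-problem summit ⇒ `QuantumAdvantage.QuantumAdvantage` by design

namespace Summit.QuantumAdvantage.QuantumAdvantage.Theorems.MeasureZeroOne

open Summit.QuantumAdvantage.QuantumAdvantage.Theses.MeasureZeroOne

/-- **`MeasureZeroOne.Dichotomy`** (stmt-QuantumAdvantage-1355): from the resource-bounded zero-one
law for `BPP` and "`BQP` is not `p`-small", either `QuantumAdvantage` or `BPP = EXP`. [folklore] -/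
theorem dichotomy_proof : Dichotomy := by
  intro hZO hNS
  by_cases hQA : _root_.QuantumAdvantage
  · exact Or.inl hQA
  rcases hZO with ⟨d, hd0, hmart, hcomp, hsucc⟩ | hEXP
  · exfalso
    apply hNS
    refine ⟨d, hd0, hmart, hcomp, fun L hL c => ?_⟩
    have hLBPP : L ∈ Literature.Computability.Complexity.BPP := by
      by_contra hnot
      exact hQA ⟨L, hL, hnot⟩
    exact hsucc L hLBPP c
  · exact Or.inr hEXP

end Summit.QuantumAdvantage.QuantumAdvantage.Theorems.MeasureZeroOne
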